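import Summits.Ventures.HSemireg.WedgeApolarSpikes

/-!
# Venture HSemireg — WHICH CLASSES ARE SIEGEL FORMS, IN EVERY CHARACTERISTIC: `w_n(q) ∈ SI_n ⇔ C(n,j)·q_j = 0 for all j ≤ n`, so
# `coSiegel_n ⊓ SI_n` is SPANNED BY THE SPIKE CLASSES `E_j` WITH `C(n,j) = 0` in `K`, has dimension `#{j ≤ n : C(n,j) = 0 in K}`, and vanishes
# iff every `C(n,j)` is a unit (I15's criterion is sharp); in characteristic `p` with `n = p` it contains `E_1, …, E_{p−1}` and neither `E_0` nor `E_p`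

HONEST FRAMING. Part of the Lean index of the computation cell `pub-hsemireg` (seat p10 gen 19, Sunday typer «UNIFORM-IN-n»).
Finite-dimensional EXTERIOR ALGEBRA + linear algebra ONLY: no variety, no cohomology theory, no sheaf, no Ext group, no semiregularity map;
nothing here says that HC / HC_CM / HC_AV holds; no Literature fact is declared or used.  Custodian versions as in `WedgeHankelSiegelIdeal` (1/3) and `WedgeHankelFrameChange`.

WHAT IS IN THE TREE.  G6 `siegelIdeal_eq_Ann_coSiegel` (`SI_n = Ann_n(coSiegel_n)`), E1 `mem_Ann`; F9/H11 `coSiegel_n_eq_span_w_spike`, `linearIndependent_w_spike`, `w_mem_coSiegel`;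
I8 `exists_eq_w_of_mem_coSiegel`; I14 `topCoeff_w_mul_w` (`topCoeff(w_n(q) ∧ w_n(q′)) = c·apolar_n(q,q′)`, `c ≠ 0`); I15 `apolar_spike_right`, and — under the hypothesis that EVERY
`C(n,p)` is non-zero in `K` — `w_mem_siegelIdeal_iff_window_zero`, `coSiegel_inf_siegelIdeal_eq_bot`.
THIS FILE (namespace `…Wedge.KernelDuality` continued; imports I15) removes that hypothesis:
* §213 **`w_mem_siegelIdeal_iff`: `w_n(q) ∈ SI_n ⇔ ∀ j ≤ n, C(n,j)·q_j = 0`** (every field); `w_spike_mem_siegelIdeal_iff` (`E_j ∈ SI_n ⇔ C(n,j) = 0` in `K`).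
* §214 **`coSiegel_inf_siegelIdeal_eq_span`: `coSiegel_n ⊓ SI_n = span{E_j : j ≤ n, C(n,j) = 0 in K}`**, **`finrank_coSiegel_inf_siegelIdeal = #{j : C(n,j) = 0}`** (`Nat.card`),
  **`coSiegel_inf_siegelIdeal_eq_bot_iff`** (`= ⊥ ⇔` every `C(n,j)`, `j ≤ n`, is non-zero in `K`: I15 §205 is sharp).
* §215 characteristic `p`, `n = p`: `E_j ∈ coSiegel_p ⊓ SI_p` for `0 < j < p` (`w_spike_mem_coSiegel_inf_siegelIdeal_of_prime`), while `E_0, E_n ∉ SI_n` always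
  (`w_spike_zero_not_mem_siegelIdeal`, `w_spike_top_not_mem_siegelIdeal`).
NOT typed here: the count `#{j ≤ n : p ∣ C(n,j)}` in closed form (Kummer/Lucas); anything Ext-side.  New names only.
-/

open Module

namespace Summit.Ventures.HSemireg.Wedge.KernelDuality

open Summit.Ventures.HSemireg.Wedge Summit.Ventures.HSemireg.Wedge.Kunneth Summit.Ventures.HSemireg.Wedge.Hankel
  Summit.Ventures.HSemireg.Wedge.BasisFree Summit.Ventures.HSemireg.Wedge.HankelSiegel Summit.Ventures.HSemireg.Wedge.HankelSiegelIdeal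
  Summit.Ventures.HSemireg.Wedge.KunnethKernel Summit.Ventures.HSemireg.Wedge.HankelRankOne Summit.Ventures.HSemireg.Wedge.HankelFrameChange

variable (K : Type*) [Field K] {n : ℕ}

/-! ## §213. The window criterion for a class to be a Siegel form -/

/-- `topCoeff(w_n(q) ∧ E_p) = c · (signs) · C(n, n−p) · q_{n−p}` vanishes iff `C(n, n−p)·q_{n−p} = 0`. -/
private lemma topCoeff_w_mul_w_spike_eq_zero_iff (q : ℕ → K) {p : ℕ} (hp : p ≤ n) :
    topCoeff K (w K n n q * w K n n (fun j => if j = p then (1 : K) else 0)) = 0 ↔ (n.choose (n - p) : K) * q (n - p) = 0 := by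
  obtain ⟨c, hc, hcc⟩ := topCoeff_w_mul_w K (n := n)
  rw [hcc, apolar_spike_right K n q hp]
  have hu : c * ((-1 : K) ^ (n * (n - 1) / 2) * (-1) ^ (n - p)) ≠ 0 :=
    mul_ne_zero hc (mul_ne_zero (pow_ne_zero _ (neg_ne_zero.mpr one_ne_zero)) (pow_ne_zero _ (neg_ne_zero.mpr one_ne_zero)))
  constructor
  · intro h
    have e : c * ((-1 : K) ^ (n * (n - 1) / 2) * (-1) ^ (n - p)) * ((n.choose (n - p) : K) * q (n - p)) = 0 := by
      rw [← h]; ring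
    exact (mul_eq_zero.mp e).resolve_left hu
  · intro h
    have e : c * ((-1 : K) ^ (n * (n - 1) / 2) * (-1) ^ (n - p) * (n.choose (n - p) : K) * q (n - p)) =
        c * ((-1 : K) ^ (n * (n - 1) / 2) * (-1) ^ (n - p)) * ((n.choose (n - p) : K) * q (n - p)) := by ring
    rw [e, h, mul_zero]

/-- **THE WINDOW CRITERION: `w_n(q) ∈ SI_n ⇔ C(n,j)·q_j = 0` for all `j ≤ n`** (every field `K`, every `n`; `SI_n = Ann_n(coSiegel_n)` and the class pairs with the
spike `E_{n−j}` to `± c·C(n,j)·q_j`). -/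
theorem w_mem_siegelIdeal_iff (q : ℕ → K) : w K n n q ∈ siegelIdeal K n n ↔ ∀ j ≤ n, (n.choose j : K) * q j = 0 := by
  rw [siegelIdeal_eq_Ann_coSiegel K (k := n) (j := n) rfl, mem_Ann]
  constructor
  · rintro ⟨-, h⟩ j hj
    have h0 := h _ (w_mem_coSiegel K (fun i => if i = n - j then (1 : K) else 0))
    rw [topCoeff_w_mul_w_spike_eq_zero_iff K q (Nat.sub_le n j), Nat.sub_sub_self hj] at h0
    exact h0
  · intro h
    have hH : w K n n q ∈ Hom K (In n) Finset.univ n := by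
      have h1 := w_mem_Hom K (n := n) le_rfl q
      rwa [Dm_top] at h1
    refine ⟨hH, fun v hv => ?_⟩
    rw [coSiegel_n_eq_span_w_spike] at hv
    induction hv using Submodule.span_induction with
    | mem s hs =>
      obtain ⟨p, rfl⟩ := hs
      rw [topCoeff_w_mul_w_spike_eq_zero_iff K q (show (p : ℕ) ≤ n by have := p.2; omega)]
      exact h _ (Nat.sub_le _ _)
    | zero => rw [mul_zero, map_zero]
    | add a b _ _ ha hb => rw [mul_add, map_add, ha, hb, add_zero]
    | smul c a _ ha => rw [mul_smul_comm, map_smul, ha, smul_zero]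

/-- **`E_j ∈ SI_n ⇔ C(n,j) = 0` in `K`** (`j ≤ n`). -/
theorem w_spike_mem_siegelIdeal_iff {j : ℕ} (hj : j ≤ n) :
    w K n n (fun i => if i = j then (1 : K) else 0) ∈ siegelIdeal K n n ↔ (n.choose j : K) = 0 := by
  rw [w_mem_siegelIdeal_iff]
  constructor
  · intro h; have := h j hj; rwa [if_pos rfl, mul_one] at this
  · intro h i _
    by_cases hij : i = j
    · rw [hij, h, zero_mul]
    · rw [if_neg hij, mul_zero]

/-- `E_0 ∉ SI_n` (`C(n,0) = 1`). -/
theorem w_spike_zero_not_mem_siegelIdeal : w K n n (fun i => if i = 0 then (1 : K) else 0) ∉ siegelIdeal K n n := by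
  rw [w_spike_mem_siegelIdeal_iff K (Nat.zero_le n), Nat.choose_zero_right, Nat.cast_one]; exact one_ne_zero

/-- `E_n ∉ SI_n` (`C(n,n) = 1`): the point class is never a Siegel form. -/
theorem w_spike_top_not_mem_siegelIdeal : w K n n (fun i => if i = n then (1 : K) else 0) ∉ siegelIdeal K n n := by
  rw [w_spike_mem_siegelIdeal_iff K le_rfl, Nat.choose_self, Nat.cast_one]; exact one_ne_zero

/-! ## §214. `coSiegel_n ⊓ SI_n` is spanned by the spikes with vanishing binomial -/

/-- th-7's class is the sum of its window entries times the spikes. -/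
private lemma w_eq_sum_smul_spike (q : ℕ → K) :
    w K n n q = ∑ p : Fin (n + 1), q p • w K n n (fun j => if j = (p : ℕ) then (1 : K) else 0) := by
  simp_rw [← w_smul]
  rw [← w_finsum]
  refine (w_eq_w_iff K _ _).2 fun j hj => ?_
  rw [Finset.sum_eq_single (⟨j, Nat.lt_succ_of_le hj⟩ : Fin (n + 1)) (fun p _ hp => ?_) (fun h => absurd (Finset.mem_univ _) h),
    if_pos rfl, mul_one]
  rw [if_neg (fun e => hp (Fin.ext e.symm)), mul_zero]

/-- **`coSiegel_n ⊓ SI_n = span{E_j : j ≤ n, C(n,j) = 0 in K}`** — the classes that are Siegel forms are exactly the combinations of the spikes whose binomial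
vanishes in `K`. -/
theorem coSiegel_inf_siegelIdeal_eq_span :
    coSiegel K n n ⊓ siegelIdeal K n n =
      Submodule.span K (Set.range fun p : {p : Fin (n + 1) // (n.choose (p : ℕ) : K) = 0} =>
        w K n n (fun j => if j = ((p : Fin (n + 1)) : ℕ) then (1 : K) else 0)) := by
  apply le_antisymm
  · intro f hf'
    obtain ⟨hf, hS⟩ := Submodule.mem_inf.mp hf'
    obtain ⟨q, rfl⟩ := exists_eq_w_of_mem_coSiegel K hf
    rw [w_mem_siegelIdeal_iff] at hS
    rw [w_eq_sum_smul_spike K q]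
    refine Submodule.sum_mem _ fun p _ => ?_
    by_cases hp : (n.choose (p : ℕ) : K) = 0
    · exact Submodule.smul_mem _ _ (Submodule.subset_span ⟨⟨p, hp⟩, rfl⟩)
    · have hq : q p = 0 := (mul_eq_zero.mp (hS p (by have := p.2; omega))).resolve_left hp
      rw [hq, zero_smul]; exact Submodule.zero_mem _
  · rw [Submodule.span_le]
    rintro _ ⟨p, rfl⟩
    exact ⟨w_mem_coSiegel K _, (w_spike_mem_siegelIdeal_iff K (by have := p.1.2; omega)).2 p.2⟩

/-- **`dim (coSiegel_n ⊓ SI_n) = #{j ≤ n : C(n,j) = 0 in K}`.** -/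
theorem finrank_coSiegel_inf_siegelIdeal :
    finrank K ↥(coSiegel K n n ⊓ siegelIdeal K n n) = Nat.card {p : Fin (n + 1) // (n.choose (p : ℕ) : K) = 0} := by
  classical
  rw [Nat.card_eq_fintype_card, coSiegel_inf_siegelIdeal_eq_span]
  exact finrank_span_eq_card ((linearIndependent_w_spike K (n := n)).comp
    (fun p : {p : Fin (n + 1) // (n.choose (p : ℕ) : K) = 0} => (p : Fin (n + 1))) Subtype.val_injective)

/-- **`coSiegel_n ⊓ SI_n = ⊥ ⇔ every C(n,j)` (`j ≤ n`) is non-zero in `K`** — I15's `coSiegel_inf_siegelIdeal_eq_bot` is sharp. -/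
theorem coSiegel_inf_siegelIdeal_eq_bot_iff : coSiegel K n n ⊓ siegelIdeal K n n = ⊥ ↔ ∀ p ≤ n, (n.choose p : K) ≠ 0 := by
  constructor
  · intro h p hp hz
    have hmem : w K n n (fun i => if i = p then (1 : K) else 0) ∈ coSiegel K n n ⊓ siegelIdeal K n n :=
      ⟨w_mem_coSiegel K _, (w_spike_mem_siegelIdeal_iff K hp).2 hz⟩
    rw [h, Submodule.mem_bot] at hmem
    have e := (w_eq_w_iff K (fun i => if i = p then (1 : K) else 0) (fun _ => (0 : K))).1 (by rw [hmem, w_zero]) p hp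
    rw [if_pos rfl] at e
    exact one_ne_zero e
  · exact coSiegel_inf_siegelIdeal_eq_bot K

/-! ## §215. Characteristic `p`, `n = p`: the inner spikes are Siegel forms -/

/-- **in characteristic `p` with `n = p` prime, `E_j ∈ coSiegel_p ⊓ SI_p` for every `0 < j < p`** (`p ∣ C(p,j)`); `E_0` and `E_p` are not (`w_spike_zero_not_mem_siegelIdeal`,
`w_spike_top_not_mem_siegelIdeal`), so `dim (coSiegel_p ⊓ SI_p) = p − 1` there (count not typed). -/
theorem w_spike_mem_coSiegel_inf_siegelIdeal_of_prime (hn : n.Prime) (hnK : (n : K) = 0) {j : ℕ} (hj0 : 0 < j) (hjn : j < n) :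
    w K n n (fun i => if i = j then (1 : K) else 0) ∈ coSiegel K n n ⊓ siegelIdeal K n n := by
  refine ⟨w_mem_coSiegel K _, (w_spike_mem_siegelIdeal_iff K hjn.le).2 ?_⟩
  obtain ⟨c, hc⟩ := hn.dvd_choose_self (Nat.pos_iff_ne_zero.mp hj0) hjn
  rw [hc, Nat.cast_mul, hnK, zero_mul]

end Summit.Ventures.HSemireg.Wedge.KernelDuality
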